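import Mathlib

/-!
# Crux `Steer` (stmt-ResolutionOfSingularities-16345), σ-residual LOW half at `p = 2`:
# `lowOrder_step_two`, NORMAL FORMS of a quadratic expression by completing the product (characteristic `2`)

OURS (campaign `res-hironaka`, rung L ★L-G4, slot W4.1, chain W4.1; seat `res-D-pv-028` g6, res-L0-w41-plan-1 RULING 15
(15b); replaces the role of no printed item; NOT a statement of the manuscript under review [claim: Hironaka2017,
status: under-review]; AI review is weaker than expert review). Pure commutative algebra in characteristic `2`:

given `F = Σ_{j,k} G_{jk} u_j u_k` in `h ∈ {2, 3, 4}` generators with the symmetrised entry `B₀₁ = G₀₁ + G₁₀` invertible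
(`B₀₁ · mui = 1`), COMPLETE THE PRODUCT: new generators `u'` (an invertible triangular change, so `(u') = (u)` as ideals)
and a new coefficient matrix `G'` with `F = Σ G'_{jk} u'_j u'_k`, `G'₀₁ = B₀₁`, and every other off-diagonal entry
ZERO — except, for `h = 4`, the entry `G'₂₃ = B₂₃ − mui (B₁₂ B₀₃ + B₁₃ B₀₂)` (the Pfaffian over `B₀₁`), which the
caller sorts into `𝔪` (rank 2) or the units (rank 4).
* `normalForm_two`, `normalForm_three`, `normalForm_four`. [folklore]
-/

-- The namespace mirrors the chain's helper layout (`…Theorems.SwitchingDichotomy.<Piece>`) on purpose.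
set_option linter.dupNamespace false

noncomputable section

namespace Summit.ResolutionOfSingularities.ResolutionOfSingularities.Theorems.SwitchingDichotomy.LowOrderNormalForm

universe u

variable {R : Type u} [CommRing R] [CharP R 2]

omit [CharP R 2] in
/-- Ideals generated by two families agreeing up to an invertible change coincide: sufficient membership test.
[folklore] -/
theorem span_range_eq_of_mem {m n : ℕ} (u : Fin m → R) (u' : Fin n → R)
    (h1 : ∀ i, u' i ∈ Ideal.span (Set.range u)) (h2 : ∀ i, u i ∈ Ideal.span (Set.range u')) :
    Ideal.span (Set.range u') = Ideal.span (Set.range u) := by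
  apply le_antisymm
  · rw [Ideal.span_le]; rintro _ ⟨i, rfl⟩; exact h1 i
  · rw [Ideal.span_le]; rintro _ ⟨i, rfl⟩; exact h2 i

omit [CharP R 2] in
/-- A member of a family lies in the ideal it generates. [folklore] -/
theorem mem_span_of_eq {n : ℕ} (u : Fin n → R) (i : Fin n) : u i ∈ Ideal.span (Set.range u) :=
  Ideal.subset_span ⟨i, rfl⟩

omit [CharP R 2] in
/-- **Normal form, two generators** (nothing to complete): `F = G₀₀ u₀² + G₁₁ u₁² + B₀₁ u₀ u₁`. [folklore] -/
theorem normalForm_two (u : Fin 2 → R) (G : Fin 2 → Fin 2 → R) :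
    ∃ G' : Fin 2 → Fin 2 → R, (∑ j, ∑ k, G j k * u j * u k) = ∑ j, ∑ k, G' j k * u j * u k ∧
      G' 0 1 = G 0 1 + G 1 0 ∧ ∀ j k, j ≠ k → ¬ (j = 0 ∧ k = 1) → G' j k = 0 := by
  refine ⟨![![G 0 0, G 0 1 + G 1 0], ![0, G 1 1]], ?_, by simp, ?_⟩
  · simp only [Fin.sum_univ_two, Matrix.cons_val_zero, Matrix.cons_val_one]
    ring
  · intro j k hjk h01
    fin_cases j <;> fin_cases k <;> simp_all

/-- **Normal form, three generators**: with `B_{jk} = G_{jk} + G_{kj}` and `B₀₁ mui = 1`, the generators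
`u₀' = u₀ + mui B₁₂ u₂`, `u₁' = u₁ + mui B₀₂ u₂`, `u₂' = u₂` carry `F = G₀₀ u₀'² + G₁₁ u₁'² + G₂₂' u₂'² + B₀₁ u₀' u₁'`
(characteristic `2`). [folklore] -/
theorem normalForm_three (u : Fin 3 → R) (G : Fin 3 → Fin 3 → R) (mui : R) (hmu : (G 0 1 + G 1 0) * mui = 1) :
    ∃ (u' : Fin 3 → R) (G' : Fin 3 → Fin 3 → R),
      Ideal.span (Set.range u') = Ideal.span (Set.range u) ∧
      (∑ j, ∑ k, G j k * u j * u k) = ∑ j, ∑ k, G' j k * u' j * u' k ∧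
      G' 0 1 = G 0 1 + G 1 0 ∧ ∀ j k, j ≠ k → ¬ (j = 0 ∧ k = 1) → G' j k = 0 := by
  have h2 : (2 : R) = 0 := CharTwo.two_eq_zero
  set B01 := G 0 1 + G 1 0 with hB01
  set B02 := G 0 2 + G 2 0 with hB02
  set B12 := G 1 2 + G 2 1 with hB12
  set u' : Fin 3 → R := ![u 0 + mui * B12 * u 2, u 1 + mui * B02 * u 2, u 2] with hu'
  have hu'0 : u' 0 = u 0 + mui * B12 * u 2 := by simp [hu']
  have hu'1 : u' 1 = u 1 + mui * B02 * u 2 := by simp [hu']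
  have hu'2 : u' 2 = u 2 := by simp [hu']
  refine ⟨u',
    ![![G 0 0, B01, 0], ![0, G 1 1, 0],
      ![0, 0, G 2 2 - mui ^ 2 * (G 0 0 * B12 ^ 2 + G 1 1 * B02 ^ 2) - mui * B12 * B02]], ?_, ?_, by simp, ?_⟩
  · refine span_range_eq_of_mem u u' (fun i => ?_) (fun i => ?_)
    · fin_cases i
      · show u' 0 ∈ _
        rw [hu'0]
        exact Ideal.add_mem _ (mem_span_of_eq u 0) (Ideal.mul_mem_left _ _ (mem_span_of_eq u 2))
      · show u' 1 ∈ _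
        rw [hu'1]
        exact Ideal.add_mem _ (mem_span_of_eq u 1) (Ideal.mul_mem_left _ _ (mem_span_of_eq u 2))
      · show u' 2 ∈ _
        rw [hu'2]
        exact mem_span_of_eq u 2
    · fin_cases i
      · show u 0 ∈ _
        have : u 0 = u' 0 - mui * B12 * u' 2 := by rw [hu'0, hu'2]; ring
        rw [this]
        exact Ideal.sub_mem _ (mem_span_of_eq u' 0) (Ideal.mul_mem_left _ _ (mem_span_of_eq u' 2))
      · show u 1 ∈ _
        have : u 1 = u' 1 - mui * B02 * u' 2 := by rw [hu'1, hu'2]; ring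
        rw [this]
        exact Ideal.sub_mem _ (mem_span_of_eq u' 1) (Ideal.mul_mem_left _ _ (mem_span_of_eq u' 2))
      · show u 2 ∈ _
        rw [← hu'2]
        exact mem_span_of_eq u' 2
  · simp only [Fin.sum_univ_three, Matrix.cons_val_zero, Matrix.cons_val_one, Matrix.cons_val_two,
      Matrix.head_cons, Matrix.tail_cons, hu'0, hu'1, hu'2]
    linear_combination (-(B02 * u 0 * u 2 + B12 * u 1 * u 2 + mui * B12 * B02 * u 2 ^ 2)) * hmu +
      (-(G 0 0 * mui * B12 * u 0 * u 2 + G 1 1 * mui * B02 * u 1 * u 2)) * h2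
  · intro j k hjk h01
    fin_cases j <;> fin_cases k <;> simp_all

/-- **Normal form, four generators**: as for three, completing with `u₀' = u₀ + mui (B₁₂ u₂ + B₁₃ u₃)`,
`u₁' = u₁ + mui (B₀₂ u₂ + B₀₃ u₃)`; the only surviving off-diagonal entries are `G'₀₁ = B₀₁` and
`G'₂₃ = B₂₃ − mui (B₁₂ B₀₃ + B₁₃ B₀₂)` (characteristic `2`). [folklore] -/
theorem normalForm_four (u : Fin 4 → R) (G : Fin 4 → Fin 4 → R) (mui : R) (hmu : (G 0 1 + G 1 0) * mui = 1) :
    ∃ (u' : Fin 4 → R) (G' : Fin 4 → Fin 4 → R),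
      Ideal.span (Set.range u') = Ideal.span (Set.range u) ∧
      (∑ j, ∑ k, G j k * u j * u k) = ∑ j, ∑ k, G' j k * u' j * u' k ∧
      G' 0 1 = G 0 1 + G 1 0 ∧
      G' 2 3 = (G 2 3 + G 3 2) - mui * ((G 1 2 + G 2 1) * (G 0 3 + G 3 0) + (G 1 3 + G 3 1) * (G 0 2 + G 2 0)) ∧
      ∀ j k, j ≠ k → ¬ (j = 0 ∧ k = 1) → ¬ (j = 2 ∧ k = 3) → G' j k = 0 := by
  have h2 : (2 : R) = 0 := CharTwo.two_eq_zero
  set B01 := G 0 1 + G 1 0 with hB01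
  set B02 := G 0 2 + G 2 0 with hB02
  set B03 := G 0 3 + G 3 0 with hB03
  set B12 := G 1 2 + G 2 1 with hB12
  set B13 := G 1 3 + G 3 1 with hB13
  set B23 := G 2 3 + G 3 2 with hB23
  set u' : Fin 4 → R := ![u 0 + mui * (B12 * u 2 + B13 * u 3), u 1 + mui * (B02 * u 2 + B03 * u 3), u 2, u 3]
    with hu'
  have hu'0 : u' 0 = u 0 + mui * (B12 * u 2 + B13 * u 3) := by simp [hu']
  have hu'1 : u' 1 = u 1 + mui * (B02 * u 2 + B03 * u 3) := by simp [hu']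
  have hu'2 : u' 2 = u 2 := by simp [hu']
  have hu'3 : u' 3 = u 3 := by simp [hu']
  refine ⟨u',
    ![![G 0 0, B01, 0, 0], ![0, G 1 1, 0, 0],
      ![0, 0, G 2 2 - mui ^ 2 * (G 0 0 * B12 ^ 2 + G 1 1 * B02 ^ 2) - mui * B12 * B02,
        B23 - mui * (B12 * B03 + B13 * B02)],
      ![0, 0, 0, G 3 3 - mui ^ 2 * (G 0 0 * B13 ^ 2 + G 1 1 * B03 ^ 2) - mui * B13 * B03]],
    ?_, ?_, by simp, by simp, ?_⟩
  · refine span_range_eq_of_mem u u' (fun i => ?_) (fun i => ?_)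
    · fin_cases i
      · show u' 0 ∈ _
        rw [hu'0]
        exact Ideal.add_mem _ (mem_span_of_eq u 0) (Ideal.mul_mem_left _ _
          (Ideal.add_mem _ (Ideal.mul_mem_left _ _ (mem_span_of_eq u 2)) (Ideal.mul_mem_left _ _ (mem_span_of_eq u 3))))
      · show u' 1 ∈ _
        rw [hu'1]
        exact Ideal.add_mem _ (mem_span_of_eq u 1) (Ideal.mul_mem_left _ _
          (Ideal.add_mem _ (Ideal.mul_mem_left _ _ (mem_span_of_eq u 2)) (Ideal.mul_mem_left _ _ (mem_span_of_eq u 3))))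
      · show u' 2 ∈ _
        rw [hu'2]; exact mem_span_of_eq u 2
      · show u' 3 ∈ _
        rw [hu'3]; exact mem_span_of_eq u 3
    · fin_cases i
      · show u 0 ∈ _
        have : u 0 = u' 0 - mui * (B12 * u' 2 + B13 * u' 3) := by rw [hu'0, hu'2, hu'3]; ring
        rw [this]
        exact Ideal.sub_mem _ (mem_span_of_eq u' 0) (Ideal.mul_mem_left _ _
          (Ideal.add_mem _ (Ideal.mul_mem_left _ _ (mem_span_of_eq u' 2)) (Ideal.mul_mem_left _ _ (mem_span_of_eq u' 3))))
      · show u 1 ∈ _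
        have : u 1 = u' 1 - mui * (B02 * u' 2 + B03 * u' 3) := by rw [hu'1, hu'2, hu'3]; ring
        rw [this]
        exact Ideal.sub_mem _ (mem_span_of_eq u' 1) (Ideal.mul_mem_left _ _
          (Ideal.add_mem _ (Ideal.mul_mem_left _ _ (mem_span_of_eq u' 2)) (Ideal.mul_mem_left _ _ (mem_span_of_eq u' 3))))
      · show u 2 ∈ _
        rw [← hu'2]; exact mem_span_of_eq u' 2
      · show u 3 ∈ _
        rw [← hu'3]; exact mem_span_of_eq u' 3
  · simp only [Fin.sum_univ_four, Matrix.cons_val_zero, Matrix.cons_val_one, Matrix.cons_val_two,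
      Matrix.cons_val_three, Matrix.head_cons, Matrix.tail_cons, hu'0, hu'1, hu'2, hu'3]
    linear_combination
      (-(B02 * u 0 * u 2 + B03 * u 0 * u 3 + B12 * u 1 * u 2 + B13 * u 1 * u 3 +
          mui * (B12 * u 2 + B13 * u 3) * (B02 * u 2 + B03 * u 3))) * hmu +
      (-(G 0 0 * mui * (B12 * u 2 + B13 * u 3) * u 0 + G 1 1 * mui * (B02 * u 2 + B03 * u 3) * u 1 +
          G 0 0 * mui ^ 2 * B12 * B13 * u 2 * u 3 + G 1 1 * mui ^ 2 * B02 * B03 * u 2 * u 3)) * h2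
  · intro j k hjk h01 h23
    fin_cases j <;> fin_cases k <;> simp_all

end Summit.ResolutionOfSingularities.ResolutionOfSingularities.Theorems.SwitchingDichotomy.LowOrderNormalForm

end
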